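import Mathlib
import HarnessLib
import HarnessLib.Audit
import Summits.AtomisticToContinuum.Statement
import HarnessLib.Audit.Status.Attr

/-!
Route: TwoTimePressureGerm

DORMANT since 2026-08-23T23:00:49Z (reconciler: no traction for 6.3 d (last activity item-evidence-added at 2026-08-17T14:47:48Z); parked, not closed — `ledger route dormant route-AtomisticToContinuum-TwoTimePressureGerm --off` to react) — unstaffed, not closed; items shared with open routes are served there. `ledger route dormant <id> --off` reactivates.

# Route TwoTimePressureGerm — the conjunct is the Euler germ of the two-time pressure; engine =
Spohn's (7.16) interchange made rigorous by N-uniform analyticity plus BMFT identification at the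
invariant Gibbs law

CONFORMING SUCCESSOR (D-0027 §2.1) of route-AtomisticToContinuum-TwoTimePressure (opened 11:45Z,
retired 13:47Z `not-a-thesis` only
because its Assembly named `Literature.…KineticTheory.HydrodynamicLimit` instead of the sub-problem
decl): same card
(two-time-pressure-symmetry), same two global cruxes, sorry-free deciding theorem `closes :
MeanEulerLimit → TiltSubGaussian →
GermOfSubGaussianMean → GermToLimit → HydrodynamicLimit`, with the engine re-typed on the vocabulary
that has landed since
(Literature `hsTwoTimePressure`/`tiltStatistic` with PROVED stationarity, convexity, Cauchy–Schwarz
and reversal symmetry; the exact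
tilt family and the analytic-type cumulant bounds of CramerEdgeLadder, SHARED verbatim as items). It
suffices to show
X = MeanEulerLimit ∧ TiltSubGaussian. The conjunct with an exponential rate is a statement about the
μ-GERM at μ = 0 of one convex
function, the upper two-time pressure of the conserved fields under the initial local Gibbs law LG =
the λ-tilt of the invariant
Gibbs law G (Ψ_N(λ,μ;t) − Ψ_N(λ,0) is exactly the scaled cgf of the time-t fields under LG):
"limsup_N [Ψ_N(λ,εμ;t) − Ψ_N(λ,0)] ≤
ε(⟨μ, Euler_t⟩ + δ)" for small ε (target EulerPressureGerm) already gives HydrodynamicLimit by the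
exponential Chebyshev inequality,
and that germ splits into SLOPE = MeanEulerLimit (the expectations of the time-t fields tend to the
Euler values: identification, NECESSARY
for the conjunct) and CURVATURE = TiltSubGaussian (an N-uniform quadratic window of the scaled cgf
around its slope: concentration in
exponential currency). ENGINE (ranked first): near every constant state both halves are Taylor data
of Ψ_N at (0,0), i.e. of a
stationary reversible measure-preserving flow (Φ, G): CumulantBounds (N-uniform analyticity radius
of Ψ_N at the origin; shared
stmt-9615) licenses the interchange of N → ∞ with λ-differentiation that Spohn performs without
proof in (7.16), and
EquilibriumResponse identifies every Taylor coefficient with the BMFT value (the (k−1)-st nonlinear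
Euler response; order 1 =
(7.18)–(7.19)); together they give the Euler germ for all small-amplitude exact-tilt data (typed:
EngineNearEq ⇒ NearEqGerm).
Lean: `MeanEulerLimit ∧ TiltSubGaussian`

## Assembly
Pure logic, certified: `theorem closes (hM : MeanEulerLimit) (hS : TiltSubGaussian) (hG :
GermOfSubGaussianMean) (hL : GermToLimit) :
HydrodynamicLimit := hL (hG hM hS)` (glue.lean; `ledger route check --native` audit OK; axioms
propext / Classical.choice / Quot.sound).
The two ranked engine cruxes are deliberately NOT hypotheses of `closes`: they reach the deciding
chain through the typed glue
EngineNearEq ⇒ NearEqGerm (small amplitude) and the foreseen zoom (Two-layer plan); σ₀ bookkeeping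
lives inside the supports.

Rationale: WHY THIS LINE. Spohn1991 §7.1 pp. 88–89 (held text read, PDF pp. 95–96): (7.16) writes the
Euler-scale equilibrium covariance as ∂_λ|₀ of the
expectation of the time-t field under the λ-TILTED Gibbs state — a local equilibrium state — and
then takes ε → 0 BEFORE ∂_λ, "according
to Eq. (3.21) the limit is governed by the Euler equations"; the same interchange at order k in λ is
the BMFT prediction that Euler-scale
joint cumulants are nonlinear Euler responses (DoyonEtAl2023 §3.1, DoyonMyers2019,
PerfettoDoyon2021, FavaEtAl2021). The interchange of
N → ∞ with λ-derivatives at 0 is EXACTLY licensed by an N-uniform analyticity radius of the finite-N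
two-time pressure (Vitali /
Cauchy estimates), which is CumulantBounds, and "no zeros of the two-time partition function pinch
the origin" is the dynamical
Lee–Yang picture of high-order cumulants (LeeYang1952, FlindtGarrahan2013); so the card's E4
becomes: analyticity radius (shared with
CramerEdgeLadder) + coefficient identification (EquilibriumResponse, this route) ⇒ the full
near-equilibrium exponential hydrodynamic
limit at FIXED small amplitude (NearEqGerm) — where CramerEdgeLadder instead descends to mesoscopic
amplitudes with order-2
identification only. Imported areas: large deviations / convex duality (Gärtner–Ellis upper bound,
KipnisLandim1999 Ch. 10,
Varadhan1993EntropyMethods), analyticity of partition functions (PulvirentiTsagkarogiannis2012),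
ballistic MFT with the explicit
dictionary tilt amplitude ↔ local Gibbs profile (TiltIdentity, exact at finite N), Onsager–Casimir
reciprocity in generating-function
form (the Literature theorem `hsTwoTimePressure_reverse`, TothValko2003, BertiniEtAl2015 §II.C) as a
free consistency constraint on
the BMFT coefficients. Unlike the board's other lines it uses no time-dependent relative entropy
(RelEntropyErgodic, VanishingNoise),
no correlation-function expansion (DenseKineticExpansion), no measure-valued or weak solutions
(BoxDissipativeWeakStrong,
StrongClosureWeakBV) and no pathwise influence: the only currency is the scaled cgf of the conserved
fields under the initial law,
and reversal enters at law level only. Negatives index (3 HydrodynamicLimit entries: 9168, 9236,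
9238) untouched — no sub-population
or adjoint-Enskog statements here.

RANKED CRUXES. FRAME (rev 1–3, 2026-08-16, after the Statement re-type p126922): the target and the
two frame cruxes #4–#5 are stated in the conjunct's PACKING-GUARDED frame — `∃ η₀ > 0` outermost
and, right after `IsHardSphereEulerSolution σ T ρ u θ`, the guard `∀ t ∈ Ico 0 T, ∀ x, ρ t x * σ^3 <
η₀` (verbatim the new `_root_.HydrodynamicLimit` prefix); the rev-0 unguarded texts imply them (take
any η₀, ignore the guard), glue takes η₀ := min. #0 EulerPressureGerm (target) — THE EULER GERM (=
exponential-rate hydrodynamic limit): ∃ η₀ > 0, for all continuous positive profiles ∃ σ₀ ∀ σ ∈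
(0,σ₀) ∀ classical hs-Euler solutions on [0,T) whose local packing fraction stays below η₀ ∀ flow
families, LLN of the local Gibbs fields at t = 0 ⇒ ∀ t < T ∀ continuous χ ∀ δ > 0 ∃ ε > 0,
eventually in N: E_LG exp((N+1)ε(F_t^χ − Euler value)) ≤ exp((N+1)εδ) for the density field, each
momentum component and the energy field (lower tails via χ ↦ −χ). Equivalent to exponential
concentration at the Euler values with N-uniformly finite scaled exponential moments near 0. (why it
might fail: it is the conjunct with an exponential rate: false if Euler-scale fluctuations of
deterministic spheres are not exponentially suppressed pre-shock (hidden slow field, as free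
streaming is for the ideal gas) or wherever the conjunct fails.) [Spohn1991, KipnisLandim1999,
DoyonEtAl2023, OllaVaradhanYau1993]
#2 EquilibriumResponse (crux) — BMFT IDENTIFICATION OF THE TAYLOR COEFFICIENTS (card E4b = Spohn's
(7.16) interchange at every order). For θe > 0, continuous directions (α,w,τ) and σ < σ₀: along the
EXACT-TILT local Gibbs family LG_d = localGibbsLaw σ a_d u_d θ_d (a_d = exp(dα +
d²|w|²/(2θe(1−dτ)))(1−dτ)^(−3/2), u_d = dw/(1−dτ), θ_d = θe/(1−dτ); = G.tilted(d(N+1)Y) by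
TiltIdentity, d = 0 the invariant law G = localGibbsLaw σ 1 0 θe), for every pinned d-family of
classical hs-Euler solutions on [0,T) (LLN-matched to LG_d at t = 0), all flows, t < T and
continuous (χ₀,χv,χ₄) with tested Euler value m(d) = ∫(χ₀ρ^d_t + Σ_j χv_j ρ^d_t u^d_t,j + χ₄E^d_t)
real-analytic at 0: for every k, (d/dd)^k|₀ E_{LG_d}[X_t] → m^(k)(0), X = n(χ₀)+Σ_j p(χv_j)_j+e(χ₄).
k = 0: static LLN + invariance; k = 1: (N+1)Cov_G(Y₀,X_t) → linearised hs-Euler transport = Spohn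
(7.18)–(7.19) = CramerEdgeLadder.EulerScaleCovariance (9616) in family form; k ≥ 2: (N+1)^k-scaled
joint cumulants κ_G(Y₀^k; X_t) → (k−1)-st NONLINEAR Euler response (BMFT) — equilibrium identities
for the stationary reversible flow (Φ,G), constrained for free by the proved reversal symmetry of
Ψ_N. [deps: TiltIdentity, CumulantBounds] [difficulty: open-problem] (why it might fail: order 1 is
Spohn's Euler-scale covariance conjecture, open at every fixed σ > 0 (a sixth slow one-body mode /
excess Drude weight falsifies it); orders ≥ 2 could converge to a non-BMFT value (e.g. an O(σ³)
Enskog-level mismatch).) [Spohn1991, DoyonEtAl2023, DoyonMyers2019, PerfettoDoyon2021, FavaEtAl2021,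
TothValko2003, BGSSCPAM2023]
#3 CumulantBounds (crux) — (VERBATIM = stmt-AtomisticToContinuum-9615, rank-2 crux of
CramerEdgeLadder — SHARED; card E4a in cumulant form) for θe > 0, directions (α,w,τ), σ < σ₀, all
flows, t ≥ 0 and (χ₀,χv,χ₄), with G_N = localGibbsLaw σ 1 0 θe, X = [n(χ₀)+p(χv)+e(χ₄)]∘Φ_t, Y =
n(α)+p(w/θe)+e(τ/θe): (i) E_G exp(s(N+1)(uX+bY)) < ∞ for |s| ≤ s₀, |u|,|b| ≤ 1; (ii)
|κ_k^G(uX+bY)|(N+1)^(k−1) ≤ C^k k! for all k ≥ 2, N, |u|,|b| ≤ 1. Equivalently the finite-N two-time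
pressure Ψ_N (Literature hsTwoTimePressure = (N+1)⁻¹·cgf) is bounded and holomorphic on a FIXED
complex polydisc at (0,0) uniformly in N: no zeros of the two-time partition function pinch the
origin. Single-time cumulants are static; the content is the N^(1−k) decay of MIXED two-time
cumulants over ≍N^(1/3) mean free times. [difficulty: open-problem] (why it might fail: mixed
two-time cumulants must decay like N^(1−k) with C^k k! constants at FIXED σ over ≍N^(1/3) collision
times; recollision/long-time-tail correlations or a zero-tilt dynamical phase transition (zeros of
the two-time partition function accumulating at 0) break it.) [Spohn1991, BGSSAnnals2023,
BGSSCPAM2023, BodineauEtAl2024, PulvirentiTsagkarogiannis2012, LeeYang1952, FlindtGarrahan2013,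
DoyonEtAl2023, SaulisStatulevicius1991]
#4 MeanEulerLimit (crux) — SLOPE OF THE GERM = IDENTIFICATION IN THE MEAN, conjunct's
(packing-guarded) frame: ∃ η₀ > 0 ∀ profiles ∃ σ₀ ∀ σ ∈ (0,σ₀) ∀ classical solutions on [0,T) with
ρ_t(x)σ³ < η₀ ∀ flows, LLN at t = 0 ⇒ ∀ t < T ∀ continuous χ, the EXPECTATIONS under the initial
local Gibbs law of the time-t density / momentum / energy fields tested against χ converge to ∫χρ_t,
∫χρ_t u_t, ∫χE_t. NECESSARY for the conjunct (uniform integrability is free; in the same guarded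
frame — the unguarded rev-0 form was no longer necessary once the conjunct was guarded) and, by the
hub's entropy bookkeeping (Liouville-pinned ∫f log f + isentropy), essentially sufficient; in
substance the mean microscopic momentum/energy currents close on the Euler fluxes with p = ρθZ(ρσ³).
Near equilibrium it is the b-slope of Ψ_N at (d,0) and follows from cruxes 2–3 (EngineNearEq ⇒
NearEqGerm); large data need the zoom. [deps: EquilibriumResponse, CumulantBounds] [difficulty:
open-problem] (why it might fail: the identification half of the conjunct: a non-Gibbsian
Euler-scale structure of the deterministic flow at fixed σ (Boltzmann-hypothesis failure, hidden
slow mode) gives non-Euler mean currents; nothing controls hard spheres beyond kinetic times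
O(N^(−1/3)).) [Spohn1991, OllaVaradhanYau1993, NachtergaeleYau2003, TothValko2003,
BodineauGallagherSaintRaymondSimonella2023]
#5 TiltSubGaussian (crux) — CURVATURE WINDOW OF THE GERM = CONCENTRATION IN EXPONENTIAL CURRENCY,
same (packing-guarded) frame: ∀ t < T ∀ continuous χ ∃ r > 0 ∃ K, EVENTUALLY in N, ∀ b ∈ [−r, r]:
E_LG exp((N+1)b(F_t^χ − E_LG F_t^χ)) ≤ exp((N+1)Kb²) for the density field, each momentum component
and the energy field — an N-uniform quadratic bound on the scaled cgf of the time-t fields around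
its slope (implies Var F_t^χ = O(1/N) and exponential concentration at the mean; near equilibrium it
is the Cauchy estimate in b at fixed real d on the polydisc of CumulantBounds). [deps:
CumulantBounds] [difficulty: open-problem] (why it might fail: needs CLT-size fluctuations of the
time-t fields with N-uniform exponential moments; anomalous Euler-scale fluctuations at fixed σ
(t^(−3/2) tails, dynamically emergent long-range correlations, pre-shock steepening, rare dense
clusters) would force r_N → 0.) [Spohn1991, DoyonEtAl2023PRL, DoyonEtAl2023, BGSSAnnals2023,
ErnstHaugeVanleeuwen1970, NachtergaeleYau2003]
#9 TiltIdentity (support) — (VERBATIM = stmt-AtomisticToContinuum-9620 of CramerEdgeLadder — SHARED)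
THE EXACT TILT (card E1 dictionary: the λ-tilt of G IS the conjunct's local Gibbs law; Spohn (7.16)
at finite N): for dτ < 1 pointwise and G_N a probability measure, localGibbsLaw σ a_d u_d θ_d N Φ =
G_N.tilted(d(N+1)Y), Y = n(α)+Σ_j p(w_j/θe)_j+e(τ/θe). Algebra verified by four refuters on 9620.
[difficulty: provable-now] [Spohn1991, GST2013]
#9 NearEqGerm (support) — THE NEAR-EQUILIBRIUM EULER GERM (milestone; small-amplitude special case
of the target on exact-tilt data): in the frame of EquilibriumResponse, if the tested Euler values
are real-analytic at d = 0 then ∀ t < T ∀ continuous χ ∃ r₁ > 0 such that for |d| < r₁ the three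
germ bounds of EulerPressureGerm hold for the data LG_d and the solution (ρ^d,u^d,θ^d) — the
exponential-rate hydrodynamic limit of deterministic hard spheres for small-amplitude analytic local
Gibbs data. Reached inside the route by EngineNearEq; claimable directly. [difficulty: open-problem]
[Spohn1991, DoyonEtAl2023, KipnisLandim1999]
#9 EngineNearEq (support) — ENGINE GLUE (provable): CumulantBounds → EquilibriumResponse →
NearEqGerm (the exact tilt, support TiltIdentity = 9620, provable now, is invoked inside the proof;
the gate renders attached items last, so it is not a formal hypothesis). By TiltIdentity
E_{LG_d}[X_t] = ∂_b K_N(d,b)|₀/(N+1), K_N = cgf_G((N+1)(dY + bX_t)); CumulantBounds (diagonal bounds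
+ polarisation) makes K_N/(N+1) a power series with coefficients ≤ C₁^k uniformly in N, bounded
holomorphic on a fixed polydisc of radius r; (a) Cauchy in b at real |d| ≤ r/2:
cgf_{LG_d}((N+1)b(X_t − g_N(d))) ≤ (N+1)Kb² for |b| ≤ r/4; (b) the Taylor coefficients of g_N(d) =
E_{LG_d}X_t are ≤ C₂r^(−i) uniformly and converge one by one (EquilibriumResponse) to those of the
analytic m, so g_N(d) → m(d) for |d| < min(r, r_m)/2 by splitting the series (no Montel); (c)
combine as in GermOfSubGaussianMean with ε = min(r/4, δ/(2K+2)); σ₀ = min(σ₀'s, 1/2); density,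
momentum components (χv = χe_i) and energy are instances of X. [difficulty: L] [Spohn1991,
SaulisStatulevicius1991, DoringEichelsbacher2012, KipnisLandim1999]
#9 GermOfSubGaussianMean (support) — MeanEulerLimit → TiltSubGaussian → EulerPressureGerm (the glue
of X; provable now): with m_N = E_LG F_t^χ and m the Euler value, E exp((N+1)ε(F − m)) =
exp((N+1)ε(m_N − m))·E exp((N+1)ε(F − m_N)) ≤ exp((N+1)(ε|m_N − m| + Kε²)) ≤ exp((N+1)εδ) for ε =
min(r, δ/(2|K|+2)) and all large N with |m_N − m| ≤ δ/2; η₀ = min of the two η₀'s (a smaller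
threshold only strengthens the guard hypothesis), σ₀ = min of the two σ₀'s; momentum componentwise
(continuity of the coordinate maps for the limit of the vector mean); the centring integrals are the
same Bochner integrals on both sides. [difficulty: provable-now] [KipnisLandim1999,
Varadhan1993EntropyMethods]
#9 GermToLimit (support) — EulerPressureGerm → HydrodynamicLimit (exponential Chebyshev; provable
now): LG(F_t^χ − m > δ) ≤ exp(−(N+1)εδ)·E exp((N+1)ε(F_t^χ − m)) ≤ exp(−(N+1)εδ/2) → 0 using the
germ at δ/2 (mul_meas_ge_le_lintegral₀); lower tails from −χ (the three fields and their targets are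
linear in χ, −χ continuous); a momentum deviation of norm > δ has a coordinate deviating by > δ/√3
(EuclideanSpace.norm_eq, Fin 3); the conclusion is the packing-guarded root def
`_root_.HydrodynamicLimit` (re-type p126922), whose prefix is literally the germ's: `rintro ⟨η₀,
hη₀, H⟩; refine ⟨η₀, hη₀, …⟩` and pass the guard hypothesis through (η₀/σ₀ bookkeeping = identity;
Sketch germToLimit_bookkeeping) — `HydrodynamicLimit.of_unguarded` is NOT usable from the guarded
germ. [difficulty: provable-now] [KipnisLandim1999, Spohn1991]

TWO-LAYER PLAN. Foreseen glued splits (k ≤ 3, depth 1), filed only when a crux closes or stalls with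
a census:
EulerPressureGerm ⇐ NearEqGerm → GermLocality → EulerPressureGerm — NearEqGerm is already typed
(support, reached by EngineNearEq from
cruxes 2–3); GermLocality is the ZOOM of card first-failure-blowup in exponential currency: exact
hyperbolic scaling covariance of the
conjunct (a ball of radius ℓ over times ℓ is the same model with (N+1)ℓ³ρ spheres and reduced
diameter ρ^(1/3)σ), a law-level light cone
for Maxwellian tails, and a restart class closed under Euler evolution (NOT local Gibbs: BMFT
predicts the time-t LD rate I∘S_t⁻¹ with
long-range correlations, DoyonEtAl2023PRL) — the honest open structural step, shared with every
near-equilibrium engine on the board.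
MeanEulerLimit and TiltSubGaussian split the same way through NearEqMean / NearEqSubGaussian (read
off NearEqGerm and step (a) of
EngineNearEq). EquilibriumResponse ⇐ Order1 (= CramerEdgeLadder.EulerScaleCovariance 9616, to be
shared by signature) → HigherOrders
(BMFT nonlinear response, k ≥ 2) → EquilibriumResponse. CumulantBounds ⇐ StaticCumulantBounds (b = 0
or u = 0: canonical cluster
expansion, in-tree HardCoreCanonical / HardSphereEulerLLN machinery) → MixedCumulantBounds →
CumulantBounds (CramerEdgeLadder foresees the
same children: one split, two routes).

KILL CRITERIA. MeanEulerLimit refuted (a profile, σ_n → 0 and t < T with non-Euler limiting mean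
fields) refutes the CONJUNCT itself (uniform
integrability is free): close `refuted:MeanEulerLimit`; every HydrodynamicLimit route inherits the
witness. TiltSubGaussian refuted with
MeanEulerLimit intact (super-CLT Euler-scale fluctuations) kills only the exponential currency: drop
TiltSubGaussian / EulerPressureGerm
and re-glue `closes` through the entropy bookkeeping in MEAN form — H(f_t | LG_{λ_t})/(N+1) =
[E_{f_0}S_{λ_0} − Π_N(λ_0)] −
[E_{f_t}S_{λ_t} − Π_N(λ_t)] → S(U_t) − S(U_0) = 0 by MeanEulerLimit, Liouville and isentropy, then
the static LD bound for local
Gibbs fields + the entropy inequality (card invariant-gibbs-entropy-bookkeeping, hub-fact shape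
stmt-4519; a `route edit`, not a new
route). EquilibriumResponse refuted at order 1 (Euler-scale equilibrium correlations are not
linearised hs-Euler at some small σ) ⇒
MeanEulerLimit false near equilibrium ⇒ conjunct false: decisive. Refuted only at some k ≥ 2 with
corrected targets ⇒ `--restate` with
the right response functional; the frame survives iff the corrected coefficients are still those of
SOME graph d ↦ S_tP_d (else BMFT
form and NearEqGerm's exponential rate are dead). CumulantBounds refuted (super-extensive mixed
cumulant, or zeros of the two-time
partition function at distance r_N → 0) ⇒ this engine and CramerEdgeLadder both die; pivot
TiltSubGaussian to variance/mixing bounds or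
close `refuted:CumulantBounds`. Implosion loophole: CLOSED by the Statement re-type (p126922) and
rev 1–3 — the conjunct and the three frame items are packing-guarded, so a dense-excursion
theorem no longer bears on any item of this route. HydrodynamicLimit proved elsewhere moots the
deciding chain (MeanEulerLimit follows) but not cruxes 2–3
(exponential rate, Euler-scale cumulant identities), which stay wanted.

NOT DECOMPOSED YET. The zoom / locality lift (see Two-layer plan) and its restart class; the static
inputs (local Gibbs laws are probability measures for
σ ≤ 1/2 — in Literature: isProbabilityMeasure_localGibbsLaw; LLN identification of (ρ,u,θ)(0) —
localGibbs_lln_holds; static analyticity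
b = 0); invariance of G under the flow (CramerEdgeLadder.HomogeneousInvariance 9621 = 3073, proof
reported in hand) and the Galilean
reduction ū = 0; the admissible energy-tilt range (inside ∃ r, ∃ ε, ∃ s₀); the complex-polydisc form
of CumulantBounds (equivalent,
not filed twice); the card's remaining structure — (S), (C), (R) are PROVED Literature theorems
(hsTwoTimePressure_zero_left,
convexOn_hsTwoTimePressure, hsTwoTimePressure_add_le, hsTwoTimePressure_reverse) and are cited, not
filed; the full BMFT form of lim Ψ_N
and its Varadhan/Gärtner–Ellis converse (card E2b), the rigidity filter E2c ((R̂S_t)² = id, I∘S_t =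
I for any exponentially
concentrating limit map) and the Guerra–Toninelli gluing existence of lim Ψ_N along dyadic N (card
E3, GuerraToninelli2002) are
layer-2 material once a crux moves — none is load-bearing for `closes`; constants r, K, C, s₀, η₀
are existential and not tracked. CRUX-ONLY `closes` (human ruling 2026-08-16): the deciding theorem
still assumes the two provable-now supports GermOfSubGaussianMean / GermToLimit (needs_repair
glue.non-crux-hypothesis, served as glue obligations); once both are proved (equivalently: once the
restated Assembly = X → Statement is proved) it becomes `theorem closes (hM : MeanEulerLimit) (hS :
TiltSubGaussian) : HydrodynamicLimit := assembly_holds hM hS` (= germToLimit (germOfSubGaussianMean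
hM hS)) by `route edit --closes-file` (Closes.lean layout / inline), no statement change.

CHEAPEST FALSIFIER. (i) IDEAL GAS (free flight, the BoltzmannHypothesis barrier's idealGasState):
Ψ_N = log of an explicit one-particle integral, N-independent — CumulantBounds and TiltSubGaussian
HOLD, EquilibriumResponse (k = 1, t > 0) and MeanEulerLimit FAIL (free streaming ≠ Euler):
pen-and-paper calibration that identification, not analyticity, carries the ergodic content and that
no item is vacuous. (ii) ORDER-2 TARGET CHECK (the predecessor card equilibrium-cumulant-bootstrap
died of wrong targets): compute m''(0) for a longitudinal (sound) tilt from the hs-Euler system with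
p = ρθZ(ρσ³) and compare with the Enskog-theory prediction of (N+1)²κ_G(Y,Y;X_t) at small σ — a
mismatch at O(σ³) kills EquilibriumResponse at k = 2 while k = 1 survives. (iii) MD at packing
0.05–0.1 (kit, not run here — plancard mode, queue saturated per 9615's notes): N-scaling of
(N+1)·Var_LG(F_t^χ) (bounded ⇔ TiltSubGaussian plausible) and of (N+1)²κ₃ of (Y₀,Y₀,X_t) vs (ii); an
N-growing value kills CumulantBounds (shared with CramerEdgeLadder's falsifier — one job serves both
routes).

NUMBERS. Items at open: 11 (1 target, 4 cruxes ranked 2–5, 5 supports, 1 assembly); rev 4: Assembly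
restated to X → Statement (`MeanEulerLimit → TiltSubGaussian → HydrodynamicLimit`, provable now =
GermToLimit ∘ GermOfSubGaussianMean; the rev-0 text only composed the two glue implications and was
tauto-trivial); 2 of them shared verbatim with CramerEdgeLadder (9615,
9620). Fluid range of hard spheres: packing (π/6)ρσ³ < 0.494 (freezing); G_N is a probability
measure for σ ≤ 1/2 (all N). Dynamical
cumulant bounds in print: BGSSAnnals2023 Thm 4 (arXiv:2008.10403 p. 33): |f^ε_{n,[0,t]}(H^{⊗n})| ≤
(Ce^{α₀})^n (t+ε)^(n−1) n! for
t ≤ T* at Boltzmann–Grad μ_ε → ∞ — same analytic-type shape, dilute/kinetic-time regime; here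
(N+1)ε³ = σ³ fixed and one macroscopic time
= ≍(N+1)^(1/3) mean free times. Euler-scale structure function: S(k,t) = exp(tA(k))S(k,0), A the
linearised Euler symbol (Spohn1991
(7.17)–(7.19), p. 88–89). Energy-tilt admissibility: |b|·sup|χ| < 1/sup θ₀ (Gaussian velocities,
energy conservation). Static
analyticity radius: canonical cluster expansion, PulvirentiTsagkarogiannis2012 Thm 2.1.

DEFINITION REQUESTS. None new: the predecessor's D1 has LANDED as
Literature/MathematicalPhysics/KineticTheory/HardSphereTwoTimePressure.lean (`Tilt`,
`tiltStatistic`, `hsTwoTimePressure` = (N+1)⁻¹·cgf, with (S), (C), Cauchy–Schwarz and (R) proved);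
`IsLinearizedHsEulerSolution`
exists (LinearizedHsEuler.lean) for the Order1 child. No cite facts requested: every input of the
supports is PROVED in Literature
(localGibbs_lln_holds, isProbabilityMeasure_localGibbsLaw, flow_flipVel_ae,
measurePreserving_flipVel_localGibbsLaw, configEnergy_eq_holds).

Novelty: Searches (2026-08-15, this session; local searchd DOWN rc 75 twice → remote cascades + galaxy): `lit
frontier AtomisticToContinuum --since 2021` (30 rows: nothing on two-time LD pressures / cgf
analyticity for Hamiltonian hard spheres; nearest doi:10.1007/s10955-026-03570-w moderate deviations
for a binary collision model, arXiv:2605.19696 cumulants of the Rayleigh gas); `lit search --source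
crossref "ballistic macroscopic fluctuation theory"` (10: Kundu 2025 doi:10.1088/1742-5468/adfe57
hard rods, Kethepalli–Urilyon–Sadhu 2026 doi:10.21468/scipostphys.20.4.105, Bodineau–Derrida 2025
doi:10.1007/s10955-025-03439-4); `--source arxiv "large deviations ballistic transport cumulant
generating function Euler"` (2: DoyonMyers2019 arXiv:1902.00320, PerfettoDoyon2021
arXiv:2012.06496); `--source crossref "hydrodynamic nonlinear response interacting integrable
systems"` (FavaEtAl2021 doi:10.1073/pnas.2106945118); `--source crossref "dynamical Lee-Yang zeros
cumulants large deviations"` (FlindtGarrahan2013 doi:10.1103/physrevlett.110.050601,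
Guéneau–Majumdar–Schehr 2025 doi:10.1103/rqsn-bzr6); `--source zbmath "hydrodynamic limit
Hamiltonian system large deviations Euler equations"` (0); `lit galaxy search "ballistic macroscopic
fluctuation theory" --star all` (3 pdf: arXiv:2412.14661, arXiv:2408.04502, PRE 110 024118 —
physics, diffusive/single-file), `"dynamical Lee-Yang zeros" --star all` (1, unrelated), `"dynamical
free energy Lee-Yang zeros" --star all` (0); held text read: Spohn1  [refs: 10.1007/s10955-026-03570-w, 10.1088/1742-5468/adfe57, 10.21468/scipostphys.20.4.105, 10.1007/s10955-025-03439-4, 10.1073/pnas.2106945118, 10.1103/physrevlett.110.050601, 10.1103/rqsn-bzr6, 10.21468/scipostphys.15.4.136, 2605.19696, 1902.00320, 2012.06496, 2412.14661, 2408.04502, doi:10.1007/s10955-026-03570-w, doi:10.1088/1742-5468/adfe57, doi:10.21468/scipostphys.20.4.105, doi:10.1007/s10955-025-]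

Barriers (technique_class: two-time-large-deviations, gartner-ellis, reversal-symmetry): - technique_class: two-time-large-deviations, gartner-ellis, reversal-symmetry
- Literature.Barriers.AtomisticToContinuum.BoltzmannHypothesisBarrier: no classification of
stationary states is assumed; the ergodic content is isolated and NAMED — EquilibriumResponse /
MeanEulerLimit (mean currents close on Euler fluxes) — while CumulantBounds / TiltSubGaussian carry
none: the barrier's ideal-gas witness (idealGasState, free flight) PASSES CumulantBounds and
TiltSubGaussian (Ψ_N is N-independent) and FAILS EquilibriumResponse at k = 1, t > 0, so the frame
is sharp exactly where the barrier bites (Cheapest falsifier (i)).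
- Literature.Barriers.AtomisticToContinuum.VelocityReversalBarrier: reversal is used only at LAW
level — the Literature identity hsTwoTimePressure_reverse between Gibbs expectations (evasions_known
(i)); every convergence statement is in exponential moments / probability under local Gibbs data and
before the first shock, where Euler is itself reversible and isentropic (scope caveat (b)); no sure
derivation, no reversal-invariant good set, flipVel enters only through the a.e. identity
flow_flipVel_ae (scope caveat (c)). The hypothesis at t = 0 is only the LLN while conclusions at t
are exponential — consistent, because the initial law is local Gibbs (static exponential
concentration is automatic; the LLN merely identifies the data).
- Literature.Barriers.AtomisticToContinuum.HighMomentumCutoffBarrier: exponential moments of the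
ENERGY field exist only for |b|·sup

History (route lifecycle, newest last):
- 2026-08-16T23:29:55Z · rev 1: restated MeanEulerLimit (stmt-AtomisticToContinuum-14333) — repair(statement-revised p126922): MeanEulerLimit restated 1:1 in the conjunct's new PACKING-GUARDED frame (∃ η₀ outermost; guard `∀ t ∈ Ico 0 T, ∀ x, ρ t x * σ (planner-rrepair-AtomisticToContinuum-TwoTimePr-eeafd188-0)
- 2026-08-16T23:33:23Z · rev 2: restated EulerPressureGerm (stmt-AtomisticToContinuum-14331) — repair(statement-revised p126922) 2/3: target EulerPressureGerm restated 1:1 in the conjunct's PACKING-GUARDED frame (∃ η₀ outermost; guard after IsHardSphereEu (planner-rrepair-AtomisticToContinuum-TwoTimePr-eeafd188-0)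
- 2026-08-16T23:33:43Z · rev 3: restated TiltSubGaussian (stmt-AtomisticToContinuum-14334) — repair(statement-revised p126922) 3/3: crux TiltSubGaussian restated 1:1 in the conjunct's PACKING-GUARDED frame (∃ η₀ outermost; guard after IsHardSphereEulerS (planner-rrepair-AtomisticToContinuum-TwoTimePr-eeafd188-0)
- 2026-08-16T23:35:31Z · rev 4: restated Assembly (stmt-AtomisticToContinuum-14339) — repair(statement-revised p126922) 4/4: (a) Assembly (stmt-14339) RESTATED to X → Statement, MeanEulerLimit → TiltSubGaussian → HydrodynamicLimit (provable now = (planner-rrepair-AtomisticToContinuum-TwoTimePr-eeafd188-0)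
- 2026-08-23T23:00:49Z · DORMANT — reconciler: no traction for 6.3 d (last activity item-evidence-added at 2026-08-17T14:47:48Z); parked, not closed — `ledger route dormant route-AtomisticToConti (operator:999:702180)

sub-problem: HydrodynamicLimit · status: dormant · opened planner-plancard-AtomisticToContinuum-Hydrody-043a2e95-g2-0 2026-08-15T19:07:25Z · rev 5 · ledger route-AtomisticToContinuum-TwoTimePressureGerm
GENERATED by the gate from the ledger (D-0016/17). Provers cite these decls: `theorem foo : Summit.AtomisticToContinuum.HydrodynamicLimit.Theses.TwoTimePressureGerm.<Decl> := …` in Summits/AtomisticToContinuum/HydrodynamicLimit/Theorems/<Name>.lean.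
-/

namespace Summit.AtomisticToContinuum.HydrodynamicLimit.Theses.TwoTimePressureGerm

open scoped BigOperators Topology Manifold Classical MeasureTheory ProbabilityTheory Matrix InnerProductSpace ComplexConjugate ContinuousMap
open Filter Set Function TopologicalSpace MeasureTheory

attribute [summit_statement] _root_.HydrodynamicLimit

-- earlier EulerPressureGerm (stmt-AtomisticToContinuum-14331, replaced 2026-08-16T23:33:23Z -> stmt-AtomisticToContinuum-17752): retired by None — open Literature.MathematicalPhysics.KineticTheory Literature.Analysis.FluidPDE MeasureTheory Filter Topology in ∀ (a₀ θ₀ : T3 → ℝ) (u₀ : T3 → V3), Continuous a₀ → Continuous θ₀ → Continuous u₀ → (∀ x, 0 < a₀ x) → (∀ x, 0 < θ₀ x) → ∃ σ₀ : ℝ, 0 < σ₀ ∧ ∀ σ :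
/-- item stmt-AtomisticToContinuum-17752 · target · rank 0 · open · by planner
why it might fail: it is the (packing-guarded) conjunct with an exponential rate: false if Euler-scale fluctuations of deterministic spheres in the dilute band are not exponentially suppressed pre-shock (hidden slow field, as free streaming is for the ideal gas) or wherever the conjunct fails.
sources: Spohn1991, KipnisLandim1999, DoyonEtAl2023, OllaVaradhanYau1993
[target] THE EULER GERM (= exponential-rate hydrodynamic limit) in the PACKING-GUARDED FRAME of the
re-typed conjunct (p126922, 2026-08-16; rev 0 was unguarded): ∃ η₀ > 0 (outermost) ∀ continuous
positive profiles ∃ σ₀ ∀ σ ∈ (0,σ₀) ∀ classical hs-Euler solutions on [0,T) WHOSE LOCAL PACKING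
FRACTION STAYS BELOW η₀ (∀ t < T ∀ x, ρ_t(x)σ³ < η₀) ∀ flow families, LLN of the local Gibbs fields
at t = 0 ⇒ ∀ t < T ∀ continuous χ ∀ δ > 0 ∃ ε > 0, eventually in N: E_LG exp((N+1)ε(F_t^χ − Euler
value)) ≤ exp((N+1)εδ) for the density field, each momentum component and the energy field (lower
tails via χ ↦ −χ). Prefix verbatim the conjunct's (`∃ η₀` outermost, guard right after
`IsHardSphereEulerSolution`), conclusion unchanged from rev 0; rev 0 ⇒ rev 1 (take any η₀, ignore
the guard — Sketch `EulerPressureGerm.of_old`), so every refuter/grounder verdict on rev 0 transfers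
a fortiori. Why restated: once the conjunct is guarded, the unguarded target asserts MORE than X →
Statement needs and inherits the implosion loophole (vacuity audit §2.28/§3.1: imploding classical
solutions reaching close packing, EOS junk branch) that the re-type removed from the conjunct.
Equivalent to exponential concent -/
@[route_item "route-AtomisticToContinuum-TwoTimePressureGerm"]
def EulerPressureGerm : Prop :=
  open Literature.MathematicalPhysics.KineticTheory Literature.Analysis.FluidPDE MeasureTheory Filter Topology in ∃ η₀ : ℝ, 0 < η₀ ∧ ∀ (a₀ θ₀ : T3 → ℝ) (u₀ : T3 → V3), Continuous a₀ → Continuous θ₀ → Continuous u₀ → (∀ x, 0 < a₀ x) → (∀ x, 0 < θ₀ x) → ∃ σ₀ : ℝ, 0 < σ₀ ∧ ∀ σ : ℝ, 0 < σ → σ < σ₀ → ∀ (T : ℝ) (ρ θ : ℝ → T3 → ℝ) (u : ℝ → T3 → V3), IsHardSphereEulerSolution σ T ρ u θ → (∀ t ∈ Set.Ico 0 T, ∀ x, ρ t x * σ ^ 3 < η₀) → ∀ Φ : (N : ℕ) → HardSphereFlow (Torus.geometry (Fin 3)) (hsDiameter σ N) (N + 1), TendstoHydroFieldsAt (fun N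 => localGibbsLaw σ a₀ u₀ θ₀ N (Φ N)) Φ ρ u θ 0 → ∀ t ∈ Set.Ico 0 T, ∀ χ : T3 → ℝ, Continuous χ → ∀ δ : ℝ, 0 < δ → ∃ ε : ℝ, 0 < ε ∧ ∀ᶠ N : ℕ in atTop, ∫⁻ z, ENNReal.ofReal (Real.exp (((N : ℝ) + 1) * ε * (empiricalDensityField ((Φ N).flow t z) χ - ∫ x, χ x * ρ t x))) ∂(localGibbsLaw σ a₀ u₀ θ₀ N (Φ N)) ≤ ENNReal.ofReal (Real.exp (((N : ℝ) + 1) * ε * δ)) ∧ (∀ i : Fin 3, ∫⁻ z, ENNReal.ofReal (Real.exp (((N : ℝ) + 1) * ε * (empiricalMomentumField ((Φ N).flow t z) χ i - (∫ x, (χ x * ρ t x) • u t x) i))) ∂(localGibbsLaw σ a₀ u₀ θ₀ N (Φ N)) ≤ ENNReal.ofReal (Real.exp (((N : ℝ) + 1) * ε * δ))) ∧ ∫⁻ z, ENNReal.ofReal (Real.exp (((N : ℝ) + 1) * ε * (empiricalEnergyField ((Φ N).flow t z) χ - ∫ x, χ x * totalEnergyDensity (ρ t x) (u t x) (θ t x))))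 ∂(localGibbsLaw σ a₀ u₀ θ₀ N (Φ N)) ≤ ENNReal.ofReal (Real.exp (((N : ℝ) + 1) * ε * δ))

/-- item stmt-AtomisticToContinuum-14332 · crux · rank 2 · open · by planner
why it might fail: order 1 is Spohn's Euler-scale covariance conjecture, open at every fixed σ > 0 (a sixth slow one-body mode / excess Drude weight falsifies it); orders ≥ 2 could converge to a non-BMFT value (e.g. an O(σ³) Enskog-level mismatch).
sources: Spohn1991, DoyonEtAl2023, DoyonMyers2019, PerfettoDoyon2021, FavaEtAl2021, TothValko2003
[crux] BMFT IDENTIFICATION OF THE TAYLOR COEFFICIENTS (card E4b = Spohn's (7.16) interchange at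
every order). For θe > 0, continuous directions (α,w,τ) and σ < σ₀: along the EXACT-TILT local Gibbs
family LG_d = localGibbsLaw σ a_d u_d θ_d (a_d = exp(dα + d²|w|²/(2θe(1−dτ)))(1−dτ)^(−3/2), u_d =
dw/(1−dτ), θ_d = θe/(1−dτ); = G.tilted(d(N+1)Y) by TiltIdentity, d = 0 the invariant law G =
localGibbsLaw σ 1 0 θe), for every pinned d-family of classical hs-Euler solutions on [0,T)
(LLN-matched to LG_d at t = 0), all flows, t < T and continuous (χ₀,χv,χ₄) with tested Euler value
m(d) = ∫(χ₀ρ^d_t + Σ_j χv_j ρ^d_t u^d_t,j + χ₄E^d_t) real-analytic at 0: for every k, (d/dd)^k|₀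
E_{LG_d}[X_t] → m^(k)(0), X = n(χ₀)+Σ_j p(χv_j)_j+e(χ₄). k = 0: static LLN + invariance; k = 1:
(N+1)Cov_G(Y₀,X_t) → linearised hs-Euler transport = Spohn (7.18)–(7.19) =
CramerEdgeLadder.EulerScaleCovariance (9616) in family form; k ≥ 2: (N+1)^k-scaled joint cumulants
κ_G(Y₀^k; X_t) → (k−1)-st NONLINEAR Euler response (BMFT) — equilibrium identities for the
stationary reversible flow (Φ,G), constrained for free by the proved reversal symmetry of Ψ_N.
[deps: TiltIdentity, CumulantBounds] [difficulty: open-problem] -/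
@[route_item "route-AtomisticToContinuum-TwoTimePressureGerm"]
def EquilibriumResponse : Prop :=
  open Literature.MathematicalPhysics.KineticTheory Literature.Analysis.FluidPDE MeasureTheory Filter Topology in ∀ θe : ℝ, 0 < θe → ∀ (α τ : T3 → ℝ) (w : T3 → V3), Continuous α → Continuous τ → Continuous w → ∃ σ₀ : ℝ, 0 < σ₀ ∧ ∀ σ : ℝ, 0 < σ → σ < σ₀ → ∀ (T r₀ : ℝ), 0 < T → 0 < r₀ → (∀ d ∈ Set.Ioo (-r₀) r₀, ∀ x, d * τ x < 1) → ∀ (ρf θf : ℝ → ℝ → T3 → ℝ) (uf : ℝ → ℝ → T3 → V3), (∀ d ∈ Set.Ioo (-r₀) r₀, IsHardSphereEulerSolution σ T (ρf d) (uf d) (θf d)) → ∀ Φ : (N : ℕ) → HardSphereFlow (Torus.geometry (Fin 3)) (hsDiameter σ N) (N + 1), let P : ℝ → (N : ℕ) → Measure (Config (N + 1) (Fin 3) T3) := fun d N => localGibbsLaw σ (fun x => Real.exp (d * α x + d ^ 2 * ‖w x‖ ^ 2 / (2 * θe * (1 - d * τ x))) * (1 - d * τ x) ^ (-(3 / 2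 : ℝ))) (fun x => (d / (1 - d * τ x)) • w x) (fun x => θe / (1 - d * τ x)) N (Φ N); (∀ d ∈ Set.Ioo (-r₀) r₀, TendstoHydroFieldsAt (P d) Φ (ρf d) (uf d) (θf d) 0) → let m : (T3 → ℝ) → (T3 → V3) → (T3 → ℝ) → ℝ → ℝ → ℝ := fun χ₀ χv χ₄ t d => ∫ x, (χ₀ x * ρf d t x + (∑ j, χv x j * (ρf d t x * uf d t x j)) + χ₄ x * totalEnergyDensity (ρf d t x) (uf d t x) (θf d t x)); let g : (T3 → ℝ) → (T3 → V3) → (T3 → ℝ) → ℝ → ℕ → ℝ → ℝ := fun χ₀ χv χ₄ t N d => ∫ z, (empiricalDensityField ((Φ N).flow t z) χ₀ + (∑ j, empiricalMomentumField ((Φ N).flow t z) (fun x => χv x j) j) + empiricalEnergyField ((Φ N).flow t z) χ₄) ∂(P d N); ∀ t ∈ Set.Ico 0 T, ∀ (χ₀ χ₄ : T3 → ℝ) (χv : T3 → V3), Continuous χ₀ → Continuous χ₄ → Continuous χv → AnalyticAt ℝ (m χ₀ χv χ₄ t) 0 → ∀ k : ℕ, Tendsto (fun N : ℕ => iteratedDeriv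 k (g χ₀ χv χ₄ t N) 0) atTop (𝓝 (iteratedDeriv k (m χ₀ χv χ₄ t) 0))

/-- item stmt-AtomisticToContinuum-9615 · crux · rank 3 · open · by planner
why it might fail: mixed two-time cumulants must decay like N^(1−k) with C^k k! constants at FIXED σ over ≍N^(1/3) collision times; recollision/long-time-tail correlations or a zero-tilt dynamical phase transition (zeros of the two-time partition function accumulating at 0) break it.
sources: Spohn1991, BGSSAnnals2023, BGSSCPAM2023, BodineauEtAl2024, PulvirentiTsagkarogiannis2012, LeeYang1952
[crux] (card crux 1, analytic type γ = 0) ANALYTIC-TYPE EQUILIBRIUM SPACE-TIME CUMULANT BOUNDS: for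
θe > 0 and continuous directions (α, w, τ) there is σ₀ such that for σ < σ₀, all flows, t ≥ 0 and
continuous test functions (χ₀, χv, χ₄): with G_N the canonical law localGibbsLaw σ 1 0 θe, X =
[n(χ₀) + p(χv) + e(χ₄)]∘Φ_t the conserved-type linear field statistic at time t and Y = n(α) +
p(w/θe) + e(τ/θe) the tilt statistic at time 0, there are C, s₀ > 0 with (i) E_G exp(s(N+1)(uX +
bY)) < ∞ for |s| ≤ s₀, |u|,|b| ≤ 1 (uniform exponential moments — statics) and (ii) |κ_k^G(uX +
bY)|·(N+1)^(k-1) ≤ C^k k! for all k ≥ 2, N, |u|,|b| ≤ 1 (κ_k = k-th derivative at 0 of the Mathlib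
cgf). Pure (single-time) cumulants are static by invariance; the content is the N^(1-k) decay of
MIXED two-time cumulants, i.e. an N-uniform real-analyticity radius of the finite-N LD pressure of
(X_t, Y_0) at the origin. [difficulty: open-problem] -/
@[route_item "route-AtomisticToContinuum-TwoTimePressureGerm"]
def CumulantBounds : Prop :=
  open Literature.MathematicalPhysics.KineticTheory Literature.Analysis.FluidPDE MeasureTheory ProbabilityTheory in ∀ θe : ℝ, 0 < θe → ∀ (α τ : T3 → ℝ) (w : T3 → V3), Continuous α → Continuous τ → Continuous w → ∃ σ₀ : ℝ, 0 < σ₀ ∧ ∀ σ : ℝ, 0 < σ → σ < σ₀ → ∀ Φ : (N : ℕ) → HardSphereFlow (Torus.geometry (Fin 3)) (hsDiameter σ N) (N + 1), ∀ t : ℝ, 0 ≤ t → ∀ (χ₀ χ₄ : T3 → ℝ) (χv : T3 → V3), Continuous χ₀ → Continuous χ₄ → Continuous χv → let G : (N : ℕ) → Measure (Config (N + 1) (Fin 3) T3) := fun N => localGibbsLaw σ (fun _ => 1) (fun _ => 0) (fun _ => θe) N (Φ N); let L : (T3 → ℝ) → (T3 → V3) → (T3 → ℝ) → (N : ℕ)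 → Config (N + 1) (Fin 3) T3 → ℝ := fun ψ₀ ψv ψ₄ _ z => empiricalDensityField z ψ₀ + (∑ j, empiricalMomentumField z (fun x => ψv x j) j) + empiricalEnergyField z ψ₄; let X : (N : ℕ) → Config (N + 1) (Fin 3) T3 → ℝ := fun N z => L χ₀ χv χ₄ N ((Φ N).flow t z); let Y : (N : ℕ) → Config (N + 1) (Fin 3) T3 → ℝ := fun N z => L α (fun x => θe⁻¹ • w x) (fun x => θe⁻¹ * τ x) N z; ∃ C s₀ : ℝ, 0 < s₀ ∧ (∀ u b : ℝ, |u| ≤ 1 → |b| ≤ 1 → ∀ N : ℕ, ∀ s : ℝ, |s| ≤ s₀ → Integrable (fun z => Real.exp (s * ((N : ℝ) + 1) * (u * X N z + b * Y N z))) (G N)) ∧ (∀ u b : ℝ, |u| ≤ 1 → |b| ≤ 1 → ∀ N k : ℕ, 2 ≤ k → |iteratedDeriv k (cgf (fun z => u * X N z + b * Y N z) (G N)) 0| * ((N : ℝ) + 1) ^ (k - 1) ≤ C ^ k * (k.factorial : ℝ))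

-- earlier MeanEulerLimit (stmt-AtomisticToContinuum-14333, replaced 2026-08-16T23:29:55Z -> stmt-AtomisticToContinuum-17727): retired by None — open Literature.MathematicalPhysics.KineticTheory Literature.Analysis.FluidPDE MeasureTheory Filter Topology in ∀ (a₀ θ₀ : T3 → ℝ) (u₀ : T3 → V3), Continuous a₀ → Continuous θ₀ → Continuous u₀ → (∀ x, 0 < a₀ x) → (∀ x, 0 < θ₀ x) → ∃ σ₀ : ℝ, 0 < σ₀ ∧ ∀ σ : ℝ,
/-- item stmt-AtomisticToContinuum-17727 · crux · rank 4 · open · by planner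
why it might fail: the identification half of the (guarded) conjunct: a non-Gibbsian Euler-scale structure of the deterministic flow at fixed σ in the dilute band (Boltzmann-hypothesis failure, hidden slow mode) gives non-Euler mean currents; nothing controls hard spheres beyond kinetic times O(N^(−1/3)).
sources: Spohn1991, OllaVaradhanYau1993, NachtergaeleYau2003, TothValko2003, BodineauGallagherSaintRaymondSimonella2023
[crux] SLOPE OF THE GERM = IDENTIFICATION IN THE MEAN, in the conjunct's PACKING-GUARDED frame
(re-type p126922; rev 0 was unguarded): ∃ η₀ > 0 ∀ profiles ∃ σ₀ ∀ σ ∈ (0,σ₀) ∀ classical solutions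
on [0,T) with ρ_t(x)σ³ < η₀ on [0,T)×𝕋³ ∀ flows, LLN at t = 0 ⇒ ∀ t < T ∀ continuous χ, the
EXPECTATIONS under the initial local Gibbs law of the time-t density / momentum / energy fields
tested against χ converge to ∫χρ_t, ∫χρ_t u_t, ∫χE_t. NECESSARY for the (guarded) conjunct again —
uniform integrability is free (|F_t^χ| ≤ sup|χ|·(1 + kinetic energy per particle), conserved by the
flow, Gaussian under LG) — whereas the rev-0 unguarded form stopped being necessary the moment the
conjunct was guarded and carried the implosion exposure alone; and, by the hub's entropy bookkeeping
(Liouville-pinned ∫f log f + isentropy), essentially sufficient. In substance the mean microscopic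
momentum/energy currents close on the Euler fluxes with p = ρθZ(ρσ³), Z on its virial disc for ρσ³ <
η₀ small. Near equilibrium it is the b-slope of Ψ_N at (d,0) and follows from cruxes 2–3
(EngineNearEq ⇒ NearEqGerm: small exact-tilt data sit in the band automatically); large data need
the zoom. rev 0 ⇒ rev 1 (ignore -/
@[route_item "route-AtomisticToContinuum-TwoTimePressureGerm", crux]
def MeanEulerLimit : Prop :=
  open Literature.MathematicalPhysics.KineticTheory Literature.Analysis.FluidPDE MeasureTheory Filter Topology in ∃ η₀ : ℝ, 0 < η₀ ∧ ∀ (a₀ θ₀ : T3 → ℝ) (u₀ : T3 → V3), Continuous a₀ → Continuous θ₀ → Continuous u₀ → (∀ x, 0 < a₀ x) → (∀ x, 0 < θ₀ x) → ∃ σ₀ : ℝ, 0 < σ₀ ∧ ∀ σ : ℝ, 0 < σ → σ < σ₀ → ∀ (T : ℝ) (ρ θ : ℝ → T3 → ℝ) (u : ℝ → T3 → V3), IsHardSphereEulerSolution σ T ρ u θ → (∀ t ∈ Set.Ico 0 T, ∀ x, ρ t x * σ ^ 3 < η₀) → ∀ Φ : (N : ℕ) → HardSphereFlow (Torus.geometry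 (Fin 3)) (hsDiameter σ N) (N + 1), TendstoHydroFieldsAt (fun N => localGibbsLaw σ a₀ u₀ θ₀ N (Φ N)) Φ ρ u θ 0 → ∀ t ∈ Set.Ico 0 T, ∀ χ : T3 → ℝ, Continuous χ → Tendsto (fun N : ℕ => ∫ z, empiricalDensityField ((Φ N).flow t z) χ ∂(localGibbsLaw σ a₀ u₀ θ₀ N (Φ N))) atTop (𝓝 (∫ x, χ x * ρ t x)) ∧ Tendsto (fun N : ℕ => ∫ z, empiricalMomentumField ((Φ N).flow t z) χ ∂(localGibbsLaw σ a₀ u₀ θ₀ N (Φ N))) atTop (𝓝 (∫ x, (χ x * ρ t x) • u t x)) ∧ Tendsto (fun N : ℕ => ∫ z, empiricalEnergyField ((Φ N).flow t z) χ ∂(localGibbsLaw σ a₀ u₀ θ₀ N (Φ N))) atTop (𝓝 (∫ x, χ x * totalEnergyDensity (ρ t x) (u t x) (θ t x)))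

-- earlier TiltSubGaussian (stmt-AtomisticToContinuum-14334, replaced 2026-08-16T23:33:43Z -> stmt-AtomisticToContinuum-17755): retired by None — open Literature.MathematicalPhysics.KineticTheory Literature.Analysis.FluidPDE MeasureTheory Filter Topology in ∀ (a₀ θ₀ : T3 → ℝ) (u₀ : T3 → V3), Continuous a₀ → Continuous θ₀ → Continuous u₀ → (∀ x, 0 < a₀ x) → (∀ x, 0 < θ₀ x) → ∃ σ₀ : ℝ, 0 < σ₀ ∧ ∀ σ : ℝ
/-- item stmt-AtomisticToContinuum-17755 · crux · rank 5 · open · by planner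
why it might fail: needs CLT-size fluctuations of the time-t fields with N-uniform exponential moments; anomalous Euler-scale fluctuations at fixed σ even in the dilute band (t^(−3/2) tails, dynamically emergent long-range correlations, pre-shock steepening, rare dense clusters) would force r_N → 0.
sources: Spohn1991, DoyonEtAl2023PRL, DoyonEtAl2023, BGSSAnnals2023, ErnstHaugeVanleeuwen1970, NachtergaeleYau2003
[crux] CURVATURE WINDOW OF THE GERM = CONCENTRATION IN EXPONENTIAL CURRENCY, same PACKING-GUARDED
frame as the re-typed conjunct (p126922: `∃ η₀` outermost, guard ρ_t(x)σ³ < η₀ along the solution on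
[0,T); rev 0 was unguarded): ∀ t < T ∀ continuous χ ∃ r > 0 ∃ K, EVENTUALLY in N, ∀ b ∈ [−r, r]:
E_LG exp((N+1)b(F_t^χ − E_LG F_t^χ)) ≤ exp((N+1)Kb²) for the density field, each momentum component
and the energy field — an N-uniform quadratic bound on the scaled cgf of the time-t fields around
its slope (implies Var F_t^χ = O(1/N) and exponential concentration at the mean; near equilibrium it
is the Cauchy estimate in b at fixed real d on the polydisc of CumulantBounds). rev 0 ⇒ rev 1
(ignore the guard; Sketch `TiltSubGaussian.of_old`); in the glue GermOfSubGaussianMean take η₀ :=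
min(η₀^Mean, η₀^Tilt) (a smaller threshold only strengthens the guard hypothesis) and σ₀ := min as
before. [deps: CumulantBounds] [difficulty: open-problem] -/
@[route_item "route-AtomisticToContinuum-TwoTimePressureGerm", crux]
def TiltSubGaussian : Prop :=
  open Literature.MathematicalPhysics.KineticTheory Literature.Analysis.FluidPDE MeasureTheory Filter Topology in ∃ η₀ : ℝ, 0 < η₀ ∧ ∀ (a₀ θ₀ : T3 → ℝ) (u₀ : T3 → V3), Continuous a₀ → Continuous θ₀ → Continuous u₀ → (∀ x, 0 < a₀ x) → (∀ x, 0 < θ₀ x) → ∃ σ₀ : ℝ, 0 < σ₀ ∧ ∀ σ : ℝ, 0 < σ → σ < σ₀ → ∀ (T : ℝ) (ρ θ : ℝ → T3 → ℝ) (u : ℝ → T3 → V3), IsHardSphereEulerSolution σ T ρ u θ → (∀ t ∈ Set.Ico 0 T, ∀ x, ρ t x * σ ^ 3 < η₀) → ∀ Φ : (N : ℕ) → HardSphereFlow (Torus.geometry (Fin 3)) (hsDiameter σ N) (N + 1), TendstoHydroFieldsAt (fun N => localGibbsLaw σ a₀ u₀ θ₀ N (Φ N)) Φ ρ u θ 0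 → ∀ t ∈ Set.Ico 0 T, ∀ χ : T3 → ℝ, Continuous χ → ∃ r : ℝ, 0 < r ∧ ∃ K : ℝ, ∀ᶠ N : ℕ in atTop, ∀ b ∈ Set.Icc (-r) r, ∫⁻ z, ENNReal.ofReal (Real.exp (((N : ℝ) + 1) * b * (empiricalDensityField ((Φ N).flow t z) χ - ∫ w, empiricalDensityField ((Φ N).flow t w) χ ∂(localGibbsLaw σ a₀ u₀ θ₀ N (Φ N))))) ∂(localGibbsLaw σ a₀ u₀ θ₀ N (Φ N)) ≤ ENNReal.ofReal (Real.exp (((N : ℝ) + 1) * K * b ^ 2)) ∧ (∀ i : Fin 3, ∫⁻ z, ENNReal.ofReal (Real.exp (((N : ℝ) + 1) * b * (empiricalMomentumField ((Φ N).flow t z) χ i - ∫ w, empiricalMomentumField ((Φ N).flow t w) χ i ∂(localGibbsLaw σ a₀ u₀ θ₀ N (Φ N))))) ∂(localGibbsLaw σ a₀ u₀ θ₀ N (Φ N)) ≤ ENNReal.ofReal (Real.exp (((N : ℝ) + 1) * K * b ^ 2))) ∧ ∫⁻ z, ENNReal.ofReal (Real.exp (((N : ℝ) + 1) * b * (empiricalEnergyField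 ((Φ N).flow t z) χ - ∫ w, empiricalEnergyField ((Φ N).flow t w) χ ∂(localGibbsLaw σ a₀ u₀ θ₀ N (Φ N))))) ∂(localGibbsLaw σ a₀ u₀ θ₀ N (Φ N)) ≤ ENNReal.ofReal (Real.exp (((N : ℝ) + 1) * K * b ^ 2))

/-- item stmt-AtomisticToContinuum-14335 · support · rank 9 · open · by planner
sources: Spohn1991, DoyonEtAl2023, KipnisLandim1999
[support] THE NEAR-EQUILIBRIUM EULER GERM (milestone; small-amplitude special case of the target on
exact-tilt data): in the frame of EquilibriumResponse, if the tested Euler values are real-analytic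
at d = 0 then ∀ t < T ∀ continuous χ ∃ r₁ > 0 such that for |d| < r₁ the three germ bounds of
EulerPressureGerm hold for the data LG_d and the solution (ρ^d,u^d,θ^d) — the exponential-rate
hydrodynamic limit of deterministic hard spheres for small-amplitude analytic local Gibbs data.
Reached inside the route by EngineNearEq; claimable directly. [difficulty: open-problem] -/
@[route_item "route-AtomisticToContinuum-TwoTimePressureGerm"]
def NearEqGerm : Prop :=
  open Literature.MathematicalPhysics.KineticTheory Literature.Analysis.FluidPDE MeasureTheory Filter Topology in ∀ θe : ℝ, 0 < θe → ∀ (α τ : T3 → ℝ) (w : T3 → V3), Continuous α → Continuous τ → Continuous w → ∃ σ₀ : ℝ, 0 < σ₀ ∧ ∀ σ : ℝ, 0 < σ → σ < σ₀ → ∀ (T r₀ : ℝ), 0 < T → 0 < r₀ → (∀ d ∈ Set.Ioo (-r₀) r₀, ∀ x, d * τ x < 1) → ∀ (ρf θf : ℝ → ℝ → T3 → ℝ) (uf : ℝ → ℝ → T3 → V3), (∀ d ∈ Set.Ioo (-r₀) r₀, IsHardSphereEulerSolution σ T (ρf d) (uf d) (θf d)) → ∀ Φ : (N : ℕ) → HardSphereFlow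 (Torus.geometry (Fin 3)) (hsDiameter σ N) (N + 1), let P : ℝ → (N : ℕ) → Measure (Config (N + 1) (Fin 3) T3) := fun d N => localGibbsLaw σ (fun x => Real.exp (d * α x + d ^ 2 * ‖w x‖ ^ 2 / (2 * θe * (1 - d * τ x))) * (1 - d * τ x) ^ (-(3 / 2 : ℝ))) (fun x => (d / (1 - d * τ x)) • w x) (fun x => θe / (1 - d * τ x)) N (Φ N); (∀ d ∈ Set.Ioo (-r₀) r₀, TendstoHydroFieldsAt (P d) Φ (ρf d) (uf d) (θf d) 0) → let m : (T3 → ℝ) → (T3 → V3) → (T3 → ℝ) → ℝ → ℝ → ℝ := fun χ₀ χv χ₄ t d => ∫ x, (χ₀ x * ρf d t x + (∑ j, χv x j * (ρf d t x * uf d t x j)) + χ₄ x * totalEnergyDensity (ρf d t x) (uf d t x) (θf d t x)); (∀ t ∈ Set.Ico 0 T, ∀ (χ₀ χ₄ : T3 → ℝ) (χv : T3 → V3), Continuous χ₀ → Continuous χ₄ → Continuous χv → AnalyticAt ℝ (m χ₀ χv χ₄ t) 0) → ∀ t ∈ Set.Ico 0 T, ∀ χ : T3 → ℝ, Continuous χ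 → ∃ r₁ : ℝ, 0 < r₁ ∧ ∀ d ∈ Set.Ioo (-r₁) r₁, ∀ δ : ℝ, 0 < δ → ∃ ε : ℝ, 0 < ε ∧ ∀ᶠ N : ℕ in atTop, ∫⁻ z, ENNReal.ofReal (Real.exp (((N : ℝ) + 1) * ε * (empiricalDensityField ((Φ N).flow t z) χ - ∫ x, χ x * ρf d t x))) ∂(P d N) ≤ ENNReal.ofReal (Real.exp (((N : ℝ) + 1) * ε * δ)) ∧ (∀ i : Fin 3, ∫⁻ z, ENNReal.ofReal (Real.exp (((N : ℝ) + 1) * ε * (empiricalMomentumField ((Φ N).flow t z) χ i - (∫ x, (χ x * ρf d t x) • uf d t x) i))) ∂(P d N) ≤ ENNReal.ofReal (Real.exp (((N : ℝ) + 1) * ε * δ))) ∧ ∫⁻ z, ENNReal.ofReal (Real.exp (((N : ℝ) + 1) * ε * (empiricalEnergyField ((Φ N).flow t z) χ - ∫ x, χ x * totalEnergyDensity (ρf d t x) (uf d t x) (θf d t x)))) ∂(P d N) ≤ ENNReal.ofReal (Real.exp (((N : ℝ) + 1) * ε * δ))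

/-- item stmt-AtomisticToContinuum-14336 · support · rank 9 · open · by planner
sources: Spohn1991, SaulisStatulevicius1991, DoringEichelsbacher2012, KipnisLandim1999
[support] ENGINE GLUE (provable): CumulantBounds → EquilibriumResponse → NearEqGerm (the exact tilt,
support TiltIdentity = 9620, provable now, is invoked inside the proof; the gate renders attached
items last, so it is not a formal hypothesis). By TiltIdentity E_{LG_d}[X_t] = ∂_b K_N(d,b)|₀/(N+1),
K_N = cgf_G((N+1)(dY + bX_t)); CumulantBounds (diagonal bounds + polarisation) makes K_N/(N+1) a
power series with coefficients ≤ C₁^k uniformly in N, bounded holomorphic on a fixed polydisc of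
radius r; (a) Cauchy in b at real |d| ≤ r/2: cgf_{LG_d}((N+1)b(X_t − g_N(d))) ≤ (N+1)Kb² for |b| ≤
r/4; (b) the Taylor coefficients of g_N(d) = E_{LG_d}X_t are ≤ C₂r^(−i) uniformly and converge one
by one (EquilibriumResponse) to those of the analytic m, so g_N(d) → m(d) for |d| < min(r, r_m)/2 by
splitting the series (no Montel); (c) combine as in GermOfSubGaussianMean with ε = min(r/4,
δ/(2K+2)); σ₀ = min(σ₀'s, 1/2); density, momentum components (χv = χe_i) and energy are instances of
X. [difficulty: L] -/
@[route_item "route-AtomisticToContinuum-TwoTimePressureGerm"]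
def EngineNearEq : Prop :=
  CumulantBounds → EquilibriumResponse → NearEqGerm

/-- item stmt-AtomisticToContinuum-14337 · support · rank 9 · open · by planner
sources: KipnisLandim1999, Varadhan1993EntropyMethods
[support] MeanEulerLimit → TiltSubGaussian → EulerPressureGerm (the glue of X; provable now): with
m_N = E_LG F_t^χ and m the Euler value, E exp((N+1)ε(F − m)) = exp((N+1)ε(m_N − m))·E exp((N+1)ε(F −
m_N)) ≤ exp((N+1)(ε|m_N − m| + Kε²)) ≤ exp((N+1)εδ) for ε = min(r, δ/(2|K|+2)) and all large N with
|m_N − m| ≤ δ/2; σ₀ = min of the two σ₀'s; momentum componentwise (continuity of the coordinate maps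
for the limit of the vector mean); the centring integrals are the same Bochner integrals on both
sides. [difficulty: provable-now] -/
@[route_item "route-AtomisticToContinuum-TwoTimePressureGerm"]
def GermOfSubGaussianMean : Prop :=
  MeanEulerLimit → TiltSubGaussian → EulerPressureGerm

/-- item stmt-AtomisticToContinuum-14338 · support · rank 9 · open · by planner
sources: KipnisLandim1999, Spohn1991
[support] EulerPressureGerm → HydrodynamicLimit (exponential Chebyshev; provable now): LG(F_t^χ − m
> δ) ≤ exp(−(N+1)εδ)·E exp((N+1)ε(F_t^χ − m)) ≤ exp(−(N+1)εδ/2) → 0 using the germ at δ/2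
(mul_meas_ge_le_lintegral₀); lower tails from −χ (the three fields and their targets are linear in
χ, −χ continuous); a momentum deviation of norm > δ has a coordinate deviating by > δ/√3
(EuclideanSpace.norm_eq, Fin 3); then hydrodynamicLimit_iff / the abbrev HydrodynamicLimit.
[difficulty: provable-now] -/
@[route_item "route-AtomisticToContinuum-TwoTimePressureGerm"]
def GermToLimit : Prop :=
  EulerPressureGerm → HydrodynamicLimit

/-- item stmt-AtomisticToContinuum-9620 · support · rank 9 · open · by planner
sources: Spohn1991, GST2013
[support] THE EXACT TILT (Spohn1991 (7.16) at finite N): for d·τ < 1 pointwise and G_N =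
localGibbsLaw σ 1 0 θe N Φ a probability measure, localGibbsLaw σ a_d u_d θ_d N Φ with a_d = exp(dα
+ d²|w|²/(2θe(1-dτ)))·(1-dτ)^(-3/2), u_d = (d/(1-dτ))w, θ_d = θe/(1-dτ) EQUALS G_N.tilted(d(N+1)Y),
Y = n(α) + Σ_j p(w_j/θe)_j + e(τ/θe): localGibbsProfile_d = localGibbsProfile(1,0,θe)·exp(d(α +
w·v/θe + τ|v|²/(2θe))) pointwise (checked by hand), canonicalDensity normalises, Measure.tilted
divides by Z_d/Z_0. Certifies that the rung's data ARE the conjunct's local Gibbs states.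
[difficulty: provable-now] -/
@[route_item "route-AtomisticToContinuum-TwoTimePressureGerm"]
def TiltIdentity : Prop :=
  open Literature.MathematicalPhysics.KineticTheory Literature.Analysis.FluidPDE MeasureTheory in ∀ (σ θe d : ℝ), 0 < θe → ∀ (α τ : T3 → ℝ) (w : T3 → V3), Continuous α → Continuous τ → Continuous w → (∀ x, d * τ x < 1) → ∀ (N : ℕ) (Φ : HardSphereFlow (Torus.geometry (Fin 3)) (hsDiameter σ N) (N + 1)), IsProbabilityMeasure (localGibbsLaw σ (fun _ => 1) (fun _ => 0) (fun _ => θe) N Φ) → localGibbsLaw σ (fun x => Real.exp (d * α x + d ^ 2 * ‖w x‖ ^ 2 / (2 * θe * (1 - d * τ x))) * (1 - d * τ x) ^ (-(3 / 2 : ℝ))) (fun x => (d / (1 - d * τ x)) • w x) (fun x => θe / (1 - d * τ x)) N Φ = (localGibbsLaw σ (fun _ => 1) (fun _ => 0) (fun _ => θe) N Φ).tilted (fun z => d * ((N : ℝ) + 1) * (empiricalDensityField z α + (∑ j, empiricalMomentumField z (fun x => θe⁻¹ * w x j) j) + empiricalEnergyField z (fun x => θe⁻¹ * τ x)))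

-- earlier Assembly (stmt-AtomisticToContinuum-14339, replaced 2026-08-16T23:35:31Z -> stmt-AtomisticToContinuum-17774): retired by None — MeanEulerLimit → TiltSubGaussian → GermOfSubGaussianMean → GermToLimit → HydrodynamicLimit
/-- item stmt-AtomisticToContinuum-17774 · assembly · rank 1 · open · by planner
sources: Spohn1991, KipnisLandim1999
[assembly] X → Statement: MeanEulerLimit → TiltSubGaussian → HydrodynamicLimit — the two frame
cruxes (slope + curvature window of the Euler germ, both in the conjunct's packing-guarded frame)
imply the packing-guarded conjunct. Provable now: GermToLimit ∘ GermOfSubGaussianMean (η₀ := min of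
the two thresholds, σ₀ := min; exponential Chebyshev), ≈ the sum of the two supports' proofs; it IS
the crux-only deciding theorem to come — once a Theorems file proves `theorem … : Assembly`, `closes
(hM : MeanEulerLimit) (hS : TiltSubGaussian) : HydrodynamicLimit := <that proof> hM hS` replaces the
present `hL (hG hM hS)`. Restated at rev 4 (2026-08-16) from the rev-0 text `MeanEulerLimit →
TiltSubGaussian → GermOfSubGaussianMean → GermToLimit → HydrodynamicLimit`, which merely composed
the two glue implications and was flagged ground.trivial (tauto) after the Statement re-type
p126922. [difficulty: provable-now (M: ≈300–500 lines, filters/ENNReal plumbing ×3 fields + one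
integrability lemma for the momentum field)] -/
@[route_item "route-AtomisticToContinuum-TwoTimePressureGerm"]
def Assembly : Prop :=
  MeanEulerLimit → TiltSubGaussian → HydrodynamicLimit

/-! D-0027 §2.1 — DECIDING THEOREM (planner-authored via `route open/edit --closes-file`; by planner-rbadge-AtomisticToContinuum-TwoTimePre-572e80a2-0 2026-08-17T00:03:52Z):
its hypotheses are this route's items and its conclusion the sub-problem Statement (glue_lint), and it elaborates with this file. -/

@[closes "route-AtomisticToContinuum-TwoTimePressureGerm"] theorem closes (hM : MeanEulerLimit) (hS : TiltSubGaussian) : HydrodynamicLimit := by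
  /- D-0027 §2.1 deciding theorem, CRUX-ONLY: the exponential-Chebyshev glue (formerly the support
  items `GermOfSubGaussianMean`, `GermToLimit`) is proved here. `η₀, σ₀ := min`. (B) for a measurable
  statistic `g_N` with means `c_N → m` and the two-sided window of `TiltSubGaussian`:
  `b₀ := min r (δ/(4(|K|+1)))`, Markov on `exp((N+1)b₀(±(g_N-c_N)))` gives
  `P_N{δ/2 < ±(g_N-c_N)} ≤ exp(-(N+1)b₀δ/4) → 0`, and `{δ<|g_N-m|} ⊆ {δ/2<|g_N-c_N|}` once
  `|c_N-m| < δ/2` (`MeanEulerLimit`). Density/energy: verbatim. Momentum: (A) the window at `b = ±r`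
  makes each coordinate integrable, so `(∫F)ᵢ = ∫Fᵢ` (`eval_integral_piLp`); each coordinate
  concentrates and (C) `{δ<‖v‖} ⊆ ⋃ᵢ{δ/2<|vᵢ|}` on `ℝ³`. (D) measurability: finite-average formulas
  and `HardSphereFlow.measurable_flow`. -/
  classical
  -- (A) two-sided exponential moments of `X - k` ⇒ `X` integrable
  have hInt : ∀ {Ω : Type} [MeasurableSpace Ω] (μ : Measure Ω) (X : Ω → ℝ) (a a' k B₁ B₂ : ℝ),
      Measurable X → a ≠ 0 → a' = -a →
      ∫⁻ z, ENNReal.ofReal (Real.exp (a * (X z - k))) ∂μ ≤ ENNReal.ofReal B₁ →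
      ∫⁻ z, ENNReal.ofReal (Real.exp (a' * (X z - k))) ∂μ ≤ ENNReal.ofReal B₂ → Integrable X μ := by
    intro Ω _ μ X a a' k B₁ B₂ hX ha ha' h₁ h₂
    subst ha'
    have hi : ∀ s B, ∫⁻ z, ENNReal.ofReal (Real.exp (s * (X z - k))) ∂μ ≤ ENNReal.ofReal B →
        Integrable (fun z => Real.exp (s * (X z - k))) μ := fun s B h =>
      ⟨((measurable_const.mul (hX.sub_const k)).exp).aestronglyMeasurable,
        (hasFiniteIntegral_iff_ofReal (Eventually.of_forall fun z => (Real.exp_pos _).le)).2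
          (h.trans_lt ENNReal.ofReal_lt_top)⟩
    have H := fun n => ProbabilityTheory.integrable_pow_of_integrable_exp_mul
      (X := fun z => X z - k) ha (hi _ _ h₁) (hi _ _ h₂) n
    exact ((H 1).add ((H 0).const_mul k)).congr (Eventually.of_forall fun z => by simp)
  -- (B) exponential Chebyshev: means converge + two-sided sub-Gaussian window ⇒ concentration
  have key : ∀ {Ω : ℕ → Type} [∀ N, MeasurableSpace (Ω N)] (P : ∀ N, Measure (Ω N))
      (g : ∀ N, Ω N → ℝ) (c : ℕ → ℝ) (m r K : ℝ), 0 < r → (∀ N, Measurable (g N)) →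
      Tendsto c atTop (𝓝 m) → (∀ᶠ N : ℕ in atTop, ∀ b ∈ Icc (-r) r,
        ∫⁻ z, ENNReal.ofReal (Real.exp (((N : ℝ) + 1) * b * (g N z - c N))) ∂P N ≤
          ENNReal.ofReal (Real.exp (((N : ℝ) + 1) * K * b ^ 2))) →
      ∀ δ : ℝ, 0 < δ → Tendsto (fun N => P N {z | δ < |g N z - m|}) atTop (𝓝 0) := by
    intro Ω _ P g c m r K hr hg hc hwin δ hδ
    obtain ⟨b₀, hb₀, hb₀r, hb₀K⟩ : ∃ b₀ : ℝ, 0 < b₀ ∧ b₀ ≤ r ∧ b₀ ≤ δ / (4 * (|K| + 1)) :=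
      ⟨min r (δ / (4 * (|K| + 1))), lt_min hr (by positivity), min_le_left _ _, min_le_right _ _⟩
    have hKb : K * b₀ ≤ δ / 4 := by
      have h1 : K * b₀ ≤ |K| * (δ / (4 * (|K| + 1))) :=
        (mul_le_mul_of_nonneg_right (le_abs_self K) hb₀.le).trans
          (mul_le_mul_of_nonneg_left hb₀K (abs_nonneg K))
      have h2 : |K| * (δ / (4 * (|K| + 1))) = δ / 4 - δ / (4 * (|K| + 1)) := by
        field_simp
        ring
      have h3 : 0 < δ / (4 * (|K| + 1)) := by positivity
      linarith
    -- one-sided tail bound from the exponential moment bound at `b₀`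
    have tail : ∀ (N : ℕ) (φ : Ω N → ℝ), Measurable φ →
        ∫⁻ z, ENNReal.ofReal (Real.exp (((N : ℝ) + 1) * b₀ * φ z)) ∂P N ≤
          ENNReal.ofReal (Real.exp (((N : ℝ) + 1) * K * b₀ ^ 2)) →
        P N {z | δ / 2 < φ z} ≤ ENNReal.ofReal (Real.exp (-(((N : ℝ) + 1) * b₀ * (δ / 4)))) := by
      intro N φ hφ hb
      have hpos : 0 < ((N : ℝ) + 1) * b₀ := by positivity
      refine (measure_mono fun z (hz : δ / 2 < φ z) => ?_).trans
        ((meas_ge_le_lintegral_div (measurable_const.mul hφ).exp.ennreal_ofReal.aemeasurable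
          (ENNReal.ofReal_pos.2 (Real.exp_pos (((N : ℝ) + 1) * b₀ * (δ / 2)))).ne'
          ENNReal.ofReal_ne_top).trans ((ENNReal.div_le_div_right hb _).trans ?_))
      · exact ENNReal.ofReal_le_ofReal (Real.exp_le_exp.2 (mul_le_mul_of_nonneg_left hz.le hpos.le))
      rw [← ENNReal.ofReal_div_of_pos (Real.exp_pos _), ← Real.exp_sub]
      refine ENNReal.ofReal_le_ofReal (Real.exp_le_exp.2 ?_)
      nlinarith [mul_nonneg hpos.le (show (0 : ℝ) ≤ δ / 4 - K * b₀ by linarith)]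
    have hlim : Tendsto (fun N : ℕ => ENNReal.ofReal (Real.exp (-(((N : ℝ) + 1) * b₀ * (δ / 4)))))
        atTop (𝓝 0) := by
      have h := ENNReal.tendsto_ofReal (Real.tendsto_exp_atBot.comp (tendsto_neg_atTop_atBot.comp
        (((tendsto_atTop_add_const_right atTop (1 : ℝ) tendsto_natCast_atTop_atTop).atTop_mul_const
          hb₀).atTop_mul_const (by positivity : (0 : ℝ) < δ / 4))))
      rwa [ENNReal.ofReal_zero] at h
    have hlim2 := hlim.add hlim
    rw [add_zero] at hlim2
    refine tendsto_of_tendsto_of_tendsto_of_le_of_le' tendsto_const_nhds hlim2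
      (Eventually.of_forall fun N => zero_le) ?_
    filter_upwards [hwin, Metric.tendsto_nhds.1 hc _ (half_pos hδ)] with N hN hcN
    rw [Real.dist_eq] at hcN
    have e1 : ∀ z, ((N : ℝ) + 1) * -b₀ * (g N z - c N) = ((N : ℝ) + 1) * b₀ * (c N - g N z) :=
      fun z => by ring
    have h₂ := hN (-b₀) ⟨by linarith, by linarith⟩
    simp only [e1, neg_sq] at h₂
    refine (measure_mono fun z hz => ?_).trans ((measure_union_le _ _).trans (add_le_add
      (tail N (fun z => g N z - c N) ((hg N).sub_const _) (hN b₀ ⟨by linarith, hb₀r⟩))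
      (tail N (fun z => c N - g N z) (measurable_const.sub (hg N)) h₂)))
    simp only [mem_setOf_eq, mem_union] at hz ⊢
    have h4 : δ / 2 < |g N z - c N| := by linarith [abs_sub_le (g N z) (c N) m]
    exact (lt_abs.1 h4).imp id fun h => by linarith
  -- (C) on `ℝ³`, a vector of norm `> δ` has a coordinate of modulus `> δ/2`
  have hcN : ∀ (v : EuclideanSpace ℝ (Fin 3)) (δ : ℝ), 0 < δ → δ < ‖v‖ → ∃ i, δ / 2 < |v i| := by
    intro v δ hδ hv
    by_contra h
    push Not at h
    have h3 : ∀ i, v i ^ 2 ≤ (δ / 2) ^ 2 := fun i => sq_le_sq' (abs_le.1 (h i)).1 (abs_le.1 (h i)).2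
    have h4 : ‖v‖ ^ 2 ≤ 3 * (δ / 2) ^ 2 := by
      rw [EuclideanSpace.real_norm_sq_eq, Fin.sum_univ_three]
      linarith [h3 0, h3 1, h3 2]
    nlinarith [norm_nonneg v, mul_pos hδ hδ]
  /- thresholds `η₀ := min η₁ η₂`, `σ₀ := min σ₁ σ₂` -/
  obtain ⟨η₁, hη₁, HM⟩ := hM
  obtain ⟨η₂, hη₂, HS⟩ := hS
  refine ⟨min η₁ η₂, lt_min hη₁ hη₂, fun a₀ θ₀ u₀ ha hθ hu ha0 hθ0 => ?_⟩
  obtain ⟨σ₁, hσ₁, HM⟩ := HM a₀ θ₀ u₀ ha hθ hu ha0 hθ0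
  obtain ⟨σ₂, hσ₂, HS⟩ := HS a₀ θ₀ u₀ ha hθ hu ha0 hθ0
  refine ⟨min σ₁ σ₂, lt_min hσ₁ hσ₂, fun σ hσ hσ' T ρ θ u hsol hη Φ h0 t ht => ?_⟩
  have HM' := HM σ hσ (hσ'.trans_le (min_le_left _ _)) T ρ θ u hsol
    (fun s hs x => (hη s hs x).trans_le (min_le_left _ _)) Φ h0 t ht
  have HS' := HS σ hσ (hσ'.trans_le (min_le_right _ _)) T ρ θ u hsol
    (fun s hs x => (hη s hs x).trans_le (min_le_right _ _)) Φ h0 t ht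
  intro χ hχ δ hδ
  obtain ⟨hm1, hm2, hm3⟩ := HM' χ hχ
  obtain ⟨r, hr, K, hev⟩ := HS' χ hχ
  -- (D) measurability of the empirical fields (finite averages of continuous one-body functions)
  have hF : ∀ n, Measurable (fun z =>
      Literature.MathematicalPhysics.KineticTheory.empiricalDensityField (N := n) z χ) ∧
      Measurable (fun z => Literature.MathematicalPhysics.KineticTheory.empiricalMomentumField
        (N := n) z χ) ∧ Measurable (fun z =>
      Literature.MathematicalPhysics.KineticTheory.empiricalEnergyField (N := n) z χ) := fun n => by
    have hp : ∀ i, Measurable fun z : Fin n → UnitAddTorus (Fin 3) × EuclideanSpace ℝ (Fin 3) =>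
      (z i).1 := fun i => (measurable_pi_apply i).fst
    have hv : ∀ i, Measurable fun z : Fin n → UnitAddTorus (Fin 3) × EuclideanSpace ℝ (Fin 3) =>
      (z i).2 := fun i => (measurable_pi_apply i).snd
    have e : ∀ z, Literature.MathematicalPhysics.KineticTheory.empiricalMomentumField (N := n) z χ =
        (n : ℝ)⁻¹ • ∑ i, χ (z i).1 • (z i).2 := fun z => by
      simp only [Literature.MathematicalPhysics.KineticTheory.empiricalMomentumField,
        Literature.Analysis.FluidPDE.empiricalMeasure_eq, integral_smul_measure]
      rw [integral_finsetSum_measure fun i _ => integrable_dirac enorm_lt_top]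
      simp [integral_dirac, ENNReal.toReal_inv]
    refine ⟨?_, ?_, ?_⟩
    · simp_rw [Literature.MathematicalPhysics.KineticTheory.empiricalDensityField,
        Literature.Analysis.FluidPDE.integral_empiricalMeasure]
      exact measurable_const.mul (Finset.measurable_sum _ fun i _ => hχ.measurable.comp (hp i))
    · simp_rw [e]
      exact (Finset.measurable_sum _ fun i _ =>
        (hχ.measurable.comp (hp i)).smul (hv i)).const_smul ((n : ℝ)⁻¹)
    · simp_rw [Literature.MathematicalPhysics.KineticTheory.empiricalEnergyField,
        Literature.Analysis.FluidPDE.integral_empiricalMeasure]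
      exact measurable_const.mul (Finset.measurable_sum _ fun i _ =>
        (hχ.measurable.comp (hp i)).mul (((hv i).norm.pow_const 2).div_const 2))
  have hFmi : ∀ N (i : Fin 3), Measurable fun z =>
      Literature.MathematicalPhysics.KineticTheory.empiricalMomentumField ((Φ N).flow t z) χ i :=
    fun N i => (PiLp.continuous_apply 2 _ i).measurable.comp ((hF _).2.1.comp ((Φ N).measurable_flow t))
  -- density and energy fields: verbatim `key`; momentum field: coordinatewise
  refine ⟨key _ (fun N z => Literature.MathematicalPhysics.KineticTheory.empiricalDensityField
      ((Φ N).flow t z) χ) _ _ r K hr (fun N => (hF _).1.comp ((Φ N).measurable_flow t)) hm1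
      (hev.mono fun N hN b hb => (hN b hb).1) δ hδ, ?_,
    key _ (fun N z => Literature.MathematicalPhysics.KineticTheory.empiricalEnergyField
      ((Φ N).flow t z) χ) _ _ r K hr (fun N => (hF _).2.2.comp ((Φ N).measurable_flow t)) hm3
      (hev.mono fun N hN b hb => (hN b hb).2.2) δ hδ⟩
  have hint := hev.mono fun N hN (i : Fin 3) => hInt _ _ _ _ _ _ _ (hFmi N i) (by positivity)
    (mul_neg _ _) ((hN r ⟨by linarith, le_rfl⟩).2.1 i) ((hN (-r) ⟨le_rfl, by linarith⟩).2.1 i)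
  have hco := fun i : Fin 3 =>
    key _ (fun N z => Literature.MathematicalPhysics.KineticTheory.empiricalMomentumField
        ((Φ N).flow t z) χ i)
      (fun N => ∫ w, Literature.MathematicalPhysics.KineticTheory.empiricalMomentumField
        ((Φ N).flow t w) χ i ∂Literature.MathematicalPhysics.KineticTheory.localGibbsLaw σ a₀ u₀ θ₀ N (Φ N))
      _ r K hr (fun N => hFmi N i) ((((PiLp.continuous_apply 2 _ i).tendsto _).comp hm2).congr'
        (hint.mono fun N hN => eval_integral_piLp hN i))
      (hev.mono fun N hN b hb => (hN b hb).2.1 i) _ (half_pos hδ)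
  have hsum := tendsto_finsetSum (Finset.univ : Finset (Fin 3)) fun i _ => hco i
  rw [Finset.sum_const_zero] at hsum
  refine tendsto_of_tendsto_of_tendsto_of_le_of_le tendsto_const_nhds hsum (fun _ => zero_le) fun N =>
    (measure_mono fun z hz => ?_).trans (measure_iUnion_fintype_le _ _)
  obtain ⟨i, hi⟩ := hcN _ δ hδ hz
  exact mem_iUnion.2 ⟨i, by simpa only [mem_setOf_eq, PiLp.sub_apply] using hi⟩

end Summit.AtomisticToContinuum.HydrodynamicLimit.Theses.TwoTimePressureGerm
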